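import Summits.AtomisticToContinuum.HydrodynamicLimit.Theorems.OneFlightGossipEngineEnergyCurrentTailsLevelCensusObjects
import Literature.MathematicalPhysics.KineticTheory.HardSphereEulerProofs
import HarnessLib

/-!
# Census closure, tools I: identities and a-priori bounds of the expected censuses
# (stub C of the line `level-census-comparison`, crux `EnergyCurrentTails`, stmt-AtomisticToContinuum-9235)

Helper file of the registered stub `stub_censusClosure` (line lead's seat c2; registered main
theorem `levelCensus_eq_shellCensus_add`, `∀`-form) over the line's vocabulary
`…LevelCensusObjects`: for the flows `Φ : Flow σ N` and the local Gibbs law `λ_N`,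
* the SHELL IDENTITY `n_s(E₁) = shell_s(E₁, E₂) + n_s(E₂)` for `E₁ ≤ E₂` (pointwise
  `𝟙{E₁ < x} = 𝟙{E₁ < x ≤ E₂} + 𝟙{E₂ < x}`, `lintegral_add_left`), monotonicity of the level census in
  the level, `shell ≤ census at the lower end`, `n_s ≤ N + 1` under a probability law;
* CHEBYSHEV `n_s(E') ≤ E'^{-1} · E∑‖vᵢ‖²` and the crude speed bound
  `speed_s(Y) ≤ Y^{-1/2} · E∑‖vᵢ‖²` (pointwise `𝟙{E' < ‖v‖²} ≤ ‖v‖²/E'`,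
  `𝟙{Y < ‖v‖²}‖v‖ ≤ ‖v‖²/√Y`);
* the DYADIC LAYER CAKE of the speed census
  `speed_s(Y) ≤ ∑'_k √(2^{k+1}Y) · shell_s(2^kY, 2^{k+1}Y)` for `Y > 0` (every speed above `√Y` lies in
  exactly one dyadic shell; `lintegral_tsum`, `lintegral_finset_sum`);
* the PAIR MAJORANT against an abstract census majorant: if `n_r(E') ≤ ofReal (nhi E')` for all
  `E'` then `pairMajorant r E Δ ≤ ofReal (merge sum + spallation sum of nhi)` (the shape consumed
  by `census_supersolution` of `…LevelCensusClosureCore`).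
Nothing is defined; no dynamics is used (only measurability of `Φ.flow s`).
-/

noncomputable section

open MeasureTheory Set Filter
open scoped ENNReal InnerProductSpace

namespace Summit.AtomisticToContinuum.HydrodynamicLimit.Theorems.EnergyCurrentTailsLevelCensus

open Literature.MathematicalPhysics.KineticTheory Literature.Analysis.FluidPDE

variable {σ : ℝ} {a₀ θ₀ : T3 → ℝ} {u₀ : T3 → V3} {N : ℕ}

/-! ## Measurability of the census integrands -/

/-- The velocity of sphere `i` at time `s` is a measurable function of the initial datum. -/
theorem measurable_vel (Φ : Flow σ N) (s : ℝ) (i : Fin (N + 1)) :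
    Measurable fun z : Config (N + 1) (Fin 3) T3 => (Φ.flow s z i).2 :=
  measurable_snd.comp ((measurable_pi_apply i).comp (Φ.measurable_flow s))

/-- The level set `{v : E < ‖v‖²}` is measurable. -/
theorem measurableSet_level (E : ℝ) : MeasurableSet {v : V3 | E < ‖v‖ ^ 2} :=
  measurableSet_lt measurable_const (measurable_norm.pow_const 2)

/-- The shell `{v : E₁ < ‖v‖² ≤ E₂}` is measurable. -/
theorem measurableSet_shell (E₁ E₂ : ℝ) : MeasurableSet {v : V3 | E₁ < ‖v‖ ^ 2 ∧ ‖v‖ ^ 2 ≤ E₂} :=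
  (measurableSet_lt measurable_const (measurable_norm.pow_const 2)).inter
    (measurableSet_le (measurable_norm.pow_const 2) measurable_const)

/-- The level-census integrand is measurable. -/
theorem measurable_levelIntegrand (Φ : Flow σ N) (s E : ℝ) :
    Measurable fun z : Config (N + 1) (Fin 3) T3 => ∑ i : Fin (N + 1),
      Set.indicator {v : V3 | E < ‖v‖ ^ 2} (fun _ => (1 : ℝ≥0∞)) ((Φ.flow s z i).2) :=
  Finset.measurable_sum _ fun i _ =>
    (measurable_const.indicator (measurableSet_level E)).comp (measurable_vel Φ s i)

/-- The shell-census integrand is measurable. -/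
theorem measurable_shellIntegrand (Φ : Flow σ N) (s E₁ E₂ : ℝ) :
    Measurable fun z : Config (N + 1) (Fin 3) T3 => ∑ i : Fin (N + 1),
      Set.indicator {v : V3 | E₁ < ‖v‖ ^ 2 ∧ ‖v‖ ^ 2 ≤ E₂} (fun _ => (1 : ℝ≥0∞)) ((Φ.flow s z i).2) :=
  Finset.measurable_sum _ fun i _ =>
    (measurable_const.indicator (measurableSet_shell E₁ E₂)).comp (measurable_vel Φ s i)

/-! ## The shell identity and monotonicity -/

/-- Pointwise shell identity: `𝟙{E₁ < ‖v‖²} = 𝟙{E₁ < ‖v‖² ≤ E₂} + 𝟙{E₂ < ‖v‖²}` for `E₁ ≤ E₂`. -/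
theorem indicator_level_eq_add {E₁ E₂ : ℝ} (h : E₁ ≤ E₂) (v : V3) :
    Set.indicator {v : V3 | E₁ < ‖v‖ ^ 2} (fun _ => (1 : ℝ≥0∞)) v
      = Set.indicator {v : V3 | E₁ < ‖v‖ ^ 2 ∧ ‖v‖ ^ 2 ≤ E₂} (fun _ => (1 : ℝ≥0∞)) v
        + Set.indicator {v : V3 | E₂ < ‖v‖ ^ 2} (fun _ => (1 : ℝ≥0∞)) v := by
  by_cases h1 : E₁ < ‖v‖ ^ 2
  · rw [Set.indicator_of_mem (show v ∈ {v : V3 | E₁ < ‖v‖ ^ 2} from h1)]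
    by_cases h2 : E₂ < ‖v‖ ^ 2
    · rw [Set.indicator_of_notMem (show v ∉ {v : V3 | E₁ < ‖v‖ ^ 2 ∧ ‖v‖ ^ 2 ≤ E₂} from
        fun hv => absurd hv.2 (not_le.2 h2)),
        Set.indicator_of_mem (show v ∈ {v : V3 | E₂ < ‖v‖ ^ 2} from h2), zero_add]
    · rw [Set.indicator_of_mem (show v ∈ {v : V3 | E₁ < ‖v‖ ^ 2 ∧ ‖v‖ ^ 2 ≤ E₂} from
        ⟨h1, not_lt.1 h2⟩), Set.indicator_of_notMem (show v ∉ {v : V3 | E₂ < ‖v‖ ^ 2} from h2),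
        add_zero]
  · have h2 : ¬ E₂ < ‖v‖ ^ 2 := fun h2 => h1 (lt_of_le_of_lt h h2)
    rw [Set.indicator_of_notMem (show v ∉ {v : V3 | E₁ < ‖v‖ ^ 2} from h1),
      Set.indicator_of_notMem (show v ∉ {v : V3 | E₁ < ‖v‖ ^ 2 ∧ ‖v‖ ^ 2 ≤ E₂} from
        fun hv => h1 hv.1),
      Set.indicator_of_notMem (show v ∉ {v : V3 | E₂ < ‖v‖ ^ 2} from h2), add_zero]

/-- **The shell identity (registered main theorem of this file, `∀`-form)**: for `E₁ ≤ E₂`,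
`n_s(E₁) = shell_s(E₁, E₂) + n_s(E₂)` in `ℝ≥0∞`. -/
theorem levelCensus_eq_shellCensus_add :
    ∀ (σ : ℝ) (a₀ θ₀ : T3 → ℝ) (u₀ : T3 → V3) (N : ℕ) (Φ : Flow σ N) (s E₁ E₂ : ℝ), E₁ ≤ E₂ →
      levelCensus σ a₀ θ₀ u₀ N Φ s E₁
        = shellCensus σ a₀ θ₀ u₀ N Φ s E₁ E₂ + levelCensus σ a₀ θ₀ u₀ N Φ s E₂ := by
  intro σ a₀ θ₀ u₀ N Φ s E₁ E₂ h
  unfold levelCensus shellCensus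
  rw [← lintegral_add_left (measurable_shellIntegrand Φ s E₁ E₂)]
  refine lintegral_congr fun z => ?_
  rw [← Finset.sum_add_distrib]
  exact Finset.sum_congr rfl fun i _ => indicator_level_eq_add h _

/-- The shell census is at most the level census at its lower end. -/
theorem shellCensus_le_levelCensus (Φ : Flow σ N) (s E₁ E₂ : ℝ) :
    shellCensus σ a₀ θ₀ u₀ N Φ s E₁ E₂ ≤ levelCensus σ a₀ θ₀ u₀ N Φ s E₁ := by
  unfold levelCensus shellCensus
  refine lintegral_mono fun z => Finset.sum_le_sum fun i _ => ?_
  exact Set.indicator_le_indicator_of_subset (fun v hv => hv.1) (fun _ => zero_le_one) _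

/-- The level census is antitone in the level. -/
theorem levelCensus_antitone (Φ : Flow σ N) (s : ℝ) {E₁ E₂ : ℝ} (h : E₁ ≤ E₂) :
    levelCensus σ a₀ θ₀ u₀ N Φ s E₂ ≤ levelCensus σ a₀ θ₀ u₀ N Φ s E₁ := by
  unfold levelCensus
  refine lintegral_mono fun z => Finset.sum_le_sum fun i _ => ?_
  exact Set.indicator_le_indicator_of_subset (fun v hv => lt_of_le_of_lt h hv)
    (fun _ => zero_le_one) _

/-- The level census is at most `N + 1` under a probability law. -/
theorem levelCensus_le_card (Φ : Flow σ N) [IsProbabilityMeasure (localGibbsLaw σ a₀ u₀ θ₀ N Φ)]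
    (s E : ℝ) : levelCensus σ a₀ θ₀ u₀ N Φ s E ≤ ((N + 1 : ℕ) : ℝ≥0∞) := by
  unfold levelCensus
  calc ∫⁻ z, (∑ i : Fin (N + 1),
          Set.indicator {v : V3 | E < ‖v‖ ^ 2} (fun _ => (1 : ℝ≥0∞)) ((Φ.flow s z i).2))
          ∂(localGibbsLaw σ a₀ u₀ θ₀ N Φ)
        ≤ ∫⁻ _z, ((N + 1 : ℕ) : ℝ≥0∞) ∂(localGibbsLaw σ a₀ u₀ θ₀ N Φ) := by
          refine lintegral_mono fun z => ?_
          calc (∑ i : Fin (N + 1),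
                Set.indicator {v : V3 | E < ‖v‖ ^ 2} (fun _ => (1 : ℝ≥0∞)) ((Φ.flow s z i).2))
              ≤ ∑ _i : Fin (N + 1), (1 : ℝ≥0∞) :=
                Finset.sum_le_sum fun i _ => Set.indicator_le_self' (fun _ _ => zero_le_one) _
            _ = ((N + 1 : ℕ) : ℝ≥0∞) := by simp
    _ = ((N + 1 : ℕ) : ℝ≥0∞) := by rw [lintegral_const, measure_univ, mul_one]

/-- The level census, as a real number, is at most `N + 1` under a probability law. -/
theorem levelCensus_toReal_le (Φ : Flow σ N) [IsProbabilityMeasure (localGibbsLaw σ a₀ u₀ θ₀ N Φ)]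
    (s E : ℝ) : (levelCensus σ a₀ θ₀ u₀ N Φ s E).toReal ≤ (N : ℝ) + 1 := by
  have h := levelCensus_le_card (a₀ := a₀) (θ₀ := θ₀) (u₀ := u₀) Φ s E
  have h' := ENNReal.toReal_mono (ENNReal.natCast_ne_top (N + 1)) h
  rw [ENNReal.toReal_natCast] at h'
  push_cast at h'
  exact h'

/-- The level census is finite under a probability law. -/
theorem levelCensus_ne_top (Φ : Flow σ N) [IsProbabilityMeasure (localGibbsLaw σ a₀ u₀ θ₀ N Φ)]
    (s E : ℝ) : levelCensus σ a₀ θ₀ u₀ N Φ s E ≠ ⊤ :=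
  ne_top_of_le_ne_top (by simp) (levelCensus_le_card Φ s E)

/-- The shell census is finite under a probability law. -/
theorem shellCensus_ne_top (Φ : Flow σ N) [IsProbabilityMeasure (localGibbsLaw σ a₀ u₀ θ₀ N Φ)]
    (s E₁ E₂ : ℝ) : shellCensus σ a₀ θ₀ u₀ N Φ s E₁ E₂ ≠ ⊤ :=
  ne_top_of_le_ne_top (levelCensus_ne_top Φ s E₁) (shellCensus_le_levelCensus Φ s E₁ E₂)

/-- The shell census as a real difference: for `E₁ ≤ E₂`,
`shell_s(E₁,E₂).toReal = n_s(E₁).toReal − n_s(E₂).toReal` under a probability law. -/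
theorem shellCensus_toReal_eq (Φ : Flow σ N) [IsProbabilityMeasure (localGibbsLaw σ a₀ u₀ θ₀ N Φ)]
    (s : ℝ) {E₁ E₂ : ℝ} (h : E₁ ≤ E₂) :
    (shellCensus σ a₀ θ₀ u₀ N Φ s E₁ E₂).toReal
      = (levelCensus σ a₀ θ₀ u₀ N Φ s E₁).toReal - (levelCensus σ a₀ θ₀ u₀ N Φ s E₂).toReal := by
  rw [levelCensus_eq_shellCensus_add σ a₀ θ₀ u₀ N Φ s E₁ E₂ h,
    ENNReal.toReal_add (shellCensus_ne_top Φ s E₁ E₂) (levelCensus_ne_top Φ s E₂)]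
  ring

/-! ## Chebyshev and the crude speed bound -/

/-- Pointwise Chebyshev: `𝟙{E' < ‖v‖²} ≤ ‖v‖²/E'` for `E' > 0`. -/
theorem indicator_level_le_sq_div {E' : ℝ} (hE' : 0 < E') (v : V3) :
    Set.indicator {v : V3 | E' < ‖v‖ ^ 2} (fun _ => (1 : ℝ≥0∞)) v
      ≤ ENNReal.ofReal (E'⁻¹) * ENNReal.ofReal (‖v‖ ^ 2) := by
  by_cases hv : E' < ‖v‖ ^ 2
  · rw [Set.indicator_of_mem (show v ∈ {v : V3 | E' < ‖v‖ ^ 2} from hv),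
      ← ENNReal.ofReal_mul (inv_nonneg.2 hE'.le), ← ENNReal.ofReal_one]
    apply ENNReal.ofReal_le_ofReal
    rw [inv_mul_eq_div, le_div_iff₀ hE']
    linarith
  · rw [Set.indicator_of_notMem (show v ∉ {v : V3 | E' < ‖v‖ ^ 2} from hv)]
    exact bot_le

/-- **Chebyshev**: `n_s(E') ≤ E'^{-1} · E_{λ_N} ∑ᵢ ‖vᵢ(s)‖²` for `E' > 0`. -/
theorem levelCensus_le_kineticEnergy (Φ : Flow σ N) (s : ℝ) {E' : ℝ} (hE' : 0 < E') :
    levelCensus σ a₀ θ₀ u₀ N Φ s E' ≤ ENNReal.ofReal (E'⁻¹) * kineticEnergy σ a₀ θ₀ u₀ N Φ s := by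
  unfold levelCensus kineticEnergy
  rw [← lintegral_const_mul' _ _ ENNReal.ofReal_ne_top]
  refine lintegral_mono fun z => ?_
  rw [ENNReal.ofReal_sum_of_nonneg (fun i _ => by positivity), Finset.mul_sum]
  exact Finset.sum_le_sum fun i _ => indicator_level_le_sq_div hE' _

/-- Pointwise: `𝟙{Y < ‖v‖²} ‖v‖ ≤ ‖v‖²/√Y` for `Y > 0`. -/
theorem indicator_speed_le_sq_div {Y : ℝ} (hY : 0 < Y) (v : V3) :
    Set.indicator {v : V3 | Y < ‖v‖ ^ 2} (fun v => ENNReal.ofReal ‖v‖) v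
      ≤ ENNReal.ofReal ((Real.sqrt Y)⁻¹) * ENNReal.ofReal (‖v‖ ^ 2) := by
  by_cases hv : Y < ‖v‖ ^ 2
  · rw [Set.indicator_of_mem (show v ∈ {v : V3 | Y < ‖v‖ ^ 2} from hv),
      ← ENNReal.ofReal_mul (inv_nonneg.2 (Real.sqrt_nonneg _))]
    apply ENNReal.ofReal_le_ofReal
    have hsY : 0 < Real.sqrt Y := Real.sqrt_pos.2 hY
    have hsv : Real.sqrt Y ≤ ‖v‖ := by
      rw [Real.sqrt_le_left (norm_nonneg _)]; exact hv.le
    rw [inv_mul_eq_div, le_div_iff₀ hsY]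
    nlinarith [norm_nonneg v]
  · rw [Set.indicator_of_notMem (show v ∉ {v : V3 | Y < ‖v‖ ^ 2} from hv)]
    exact bot_le

/-- **Crude speed bound**: `speed_s(Y) ≤ Y^{-1/2} · E_{λ_N} ∑ᵢ ‖vᵢ(s)‖²` for `Y > 0`. -/
theorem speedCensus_le_kineticEnergy (Φ : Flow σ N) (s : ℝ) {Y : ℝ} (hY : 0 < Y) :
    speedCensus σ a₀ θ₀ u₀ N Φ s Y
      ≤ ENNReal.ofReal ((Real.sqrt Y)⁻¹) * kineticEnergy σ a₀ θ₀ u₀ N Φ s := by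
  unfold speedCensus kineticEnergy
  rw [← lintegral_const_mul' _ _ ENNReal.ofReal_ne_top]
  refine lintegral_mono fun z => ?_
  rw [ENNReal.ofReal_sum_of_nonneg (fun i _ => by positivity), Finset.mul_sum]
  exact Finset.sum_le_sum fun i _ => indicator_speed_le_sq_div hY _

/-! ## The dyadic layer cake of the speed census -/

/-- Every speed above `√Y` (`Y > 0`) lies in a dyadic shell `(2^kY, 2^{k+1}Y]`, so
`𝟙{Y < ‖v‖²} ‖v‖ ≤ ∑'_k √(2^{k+1}Y) 𝟙{2^kY < ‖v‖² ≤ 2^{k+1}Y}`. -/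
theorem indicator_speed_le_tsum {Y : ℝ} (hY : 0 < Y) (v : V3) :
    Set.indicator {v : V3 | Y < ‖v‖ ^ 2} (fun v => ENNReal.ofReal ‖v‖) v
      ≤ ∑' k : ℕ, ENNReal.ofReal (Real.sqrt (2 ^ (k + 1) * Y)) *
          Set.indicator {v : V3 | 2 ^ k * Y < ‖v‖ ^ 2 ∧ ‖v‖ ^ 2 ≤ 2 ^ (k + 1) * Y}
            (fun _ => (1 : ℝ≥0∞)) v := by
  by_cases hv : Y < ‖v‖ ^ 2
  · rw [Set.indicator_of_mem (show v ∈ {v : V3 | Y < ‖v‖ ^ 2} from hv)]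
    -- the dyadic shell containing `‖v‖²`: the least `k` with `‖v‖² ≤ 2^{k+1} Y`
    have hex : ∃ k : ℕ, ‖v‖ ^ 2 ≤ 2 ^ (k + 1) * Y := by
      obtain ⟨k, hk⟩ := pow_unbounded_of_one_lt (‖v‖ ^ 2 / Y) (by norm_num : (1 : ℝ) < 2)
      refine ⟨k, ?_⟩
      rw [div_lt_iff₀ hY] at hk
      have : (2 : ℝ) ^ k * Y ≤ 2 ^ (k + 1) * Y := by
        rw [pow_succ]; nlinarith [pow_pos (show (0 : ℝ) < 2 by norm_num) k]
      linarith
    classical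
    set k := Nat.find hex with hk
    have hk₁ : ‖v‖ ^ 2 ≤ 2 ^ (k + 1) * Y := Nat.find_spec hex
    have hk₂ : 2 ^ k * Y < ‖v‖ ^ 2 := by
      rcases Nat.eq_zero_or_pos k with h0 | hpos
      · rw [h0, pow_zero, one_mul]; exact hv
      · have h := Nat.find_min hex (m := k - 1) (by omega)
        rw [not_le] at h
        have : k - 1 + 1 = k := by omega
        rw [this] at h
        exact h
    have hmem : v ∈ {v : V3 | 2 ^ k * Y < ‖v‖ ^ 2 ∧ ‖v‖ ^ 2 ≤ 2 ^ (k + 1) * Y} := ⟨hk₂, hk₁⟩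
    calc ENNReal.ofReal ‖v‖ ≤ ENNReal.ofReal (Real.sqrt (2 ^ (k + 1) * Y)) * 1 := by
          rw [mul_one]
          apply ENNReal.ofReal_le_ofReal
          rw [Real.le_sqrt (norm_nonneg _) (by positivity)]
          exact hk₁
      _ = ENNReal.ofReal (Real.sqrt (2 ^ (k + 1) * Y)) *
          Set.indicator {v : V3 | 2 ^ k * Y < ‖v‖ ^ 2 ∧ ‖v‖ ^ 2 ≤ 2 ^ (k + 1) * Y}
            (fun _ => (1 : ℝ≥0∞)) v := by rw [Set.indicator_of_mem hmem]
      _ ≤ ∑' k : ℕ, ENNReal.ofReal (Real.sqrt (2 ^ (k + 1) * Y)) *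
          Set.indicator {v : V3 | 2 ^ k * Y < ‖v‖ ^ 2 ∧ ‖v‖ ^ 2 ≤ 2 ^ (k + 1) * Y}
            (fun _ => (1 : ℝ≥0∞)) v := ENNReal.le_tsum k
  · rw [Set.indicator_of_notMem (show v ∉ {v : V3 | Y < ‖v‖ ^ 2} from hv)]
    exact bot_le

/-- **Dyadic layer cake**: `speed_s(Y) ≤ ∑'_k √(2^{k+1}Y) · shell_s(2^kY, 2^{k+1}Y)` for `Y > 0`. -/
theorem speedCensus_le_tsum_shellCensus (Φ : Flow σ N) (s : ℝ) {Y : ℝ} (hY : 0 < Y) :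
    speedCensus σ a₀ θ₀ u₀ N Φ s Y
      ≤ ∑' k : ℕ, ENNReal.ofReal (Real.sqrt (2 ^ (k + 1) * Y)) *
          shellCensus σ a₀ θ₀ u₀ N Φ s (2 ^ k * Y) (2 ^ (k + 1) * Y) := by
  unfold speedCensus shellCensus
  have hmeas : ∀ k : ℕ, Measurable fun z : Config (N + 1) (Fin 3) T3 =>
      ENNReal.ofReal (Real.sqrt (2 ^ (k + 1) * Y)) * ∑ i : Fin (N + 1),
        Set.indicator {v : V3 | 2 ^ k * Y < ‖v‖ ^ 2 ∧ ‖v‖ ^ 2 ≤ 2 ^ (k + 1) * Y}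
          (fun _ => (1 : ℝ≥0∞)) ((Φ.flow s z i).2) :=
    fun k => (measurable_shellIntegrand Φ s _ _).const_mul _
  calc ∫⁻ z, (∑ i : Fin (N + 1),
        Set.indicator {v : V3 | Y < ‖v‖ ^ 2} (fun v => ENNReal.ofReal ‖v‖) ((Φ.flow s z i).2))
        ∂(localGibbsLaw σ a₀ u₀ θ₀ N Φ)
      ≤ ∫⁻ z, ∑' k : ℕ, ENNReal.ofReal (Real.sqrt (2 ^ (k + 1) * Y)) * ∑ i : Fin (N + 1),
          Set.indicator {v : V3 | 2 ^ k * Y < ‖v‖ ^ 2 ∧ ‖v‖ ^ 2 ≤ 2 ^ (k + 1) * Y}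
            (fun _ => (1 : ℝ≥0∞)) ((Φ.flow s z i).2) ∂(localGibbsLaw σ a₀ u₀ θ₀ N Φ) := by
        refine lintegral_mono fun z => ?_
        calc (∑ i : Fin (N + 1),
              Set.indicator {v : V3 | Y < ‖v‖ ^ 2} (fun v => ENNReal.ofReal ‖v‖) ((Φ.flow s z i).2))
            ≤ ∑ i : Fin (N + 1), ∑' k : ℕ, ENNReal.ofReal (Real.sqrt (2 ^ (k + 1) * Y)) *
                Set.indicator {v : V3 | 2 ^ k * Y < ‖v‖ ^ 2 ∧ ‖v‖ ^ 2 ≤ 2 ^ (k + 1) * Y}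
                  (fun _ => (1 : ℝ≥0∞)) ((Φ.flow s z i).2) :=
              Finset.sum_le_sum fun i _ => indicator_speed_le_tsum hY _
          _ = ∑' k : ℕ, ∑ i : Fin (N + 1), ENNReal.ofReal (Real.sqrt (2 ^ (k + 1) * Y)) *
                Set.indicator {v : V3 | 2 ^ k * Y < ‖v‖ ^ 2 ∧ ‖v‖ ^ 2 ≤ 2 ^ (k + 1) * Y}
                  (fun _ => (1 : ℝ≥0∞)) ((Φ.flow s z i).2) :=
              (Summable.tsum_finsetSum fun i _ => ENNReal.summable).symm
          _ = ∑' k : ℕ, ENNReal.ofReal (Real.sqrt (2 ^ (k + 1) * Y)) * ∑ i : Fin (N + 1),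
                Set.indicator {v : V3 | 2 ^ k * Y < ‖v‖ ^ 2 ∧ ‖v‖ ^ 2 ≤ 2 ^ (k + 1) * Y}
                  (fun _ => (1 : ℝ≥0∞)) ((Φ.flow s z i).2) := by
              congr 1; ext k; rw [Finset.mul_sum]
    _ = ∑' k : ℕ, ∫⁻ z, ENNReal.ofReal (Real.sqrt (2 ^ (k + 1) * Y)) * ∑ i : Fin (N + 1),
          Set.indicator {v : V3 | 2 ^ k * Y < ‖v‖ ^ 2 ∧ ‖v‖ ^ 2 ≤ 2 ^ (k + 1) * Y}
            (fun _ => (1 : ℝ≥0∞)) ((Φ.flow s z i).2) ∂(localGibbsLaw σ a₀ u₀ θ₀ N Φ) :=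
        lintegral_tsum fun k => (hmeas k).aemeasurable
    _ = ∑' k : ℕ, ENNReal.ofReal (Real.sqrt (2 ^ (k + 1) * Y)) * ∫⁻ z, ∑ i : Fin (N + 1),
          Set.indicator {v : V3 | 2 ^ k * Y < ‖v‖ ^ 2 ∧ ‖v‖ ^ 2 ≤ 2 ^ (k + 1) * Y}
            (fun _ => (1 : ℝ≥0∞)) ((Φ.flow s z i).2) ∂(localGibbsLaw σ a₀ u₀ θ₀ N Φ) := by
        congr 1; ext k
        exact lintegral_const_mul _ (measurable_shellIntegrand Φ s _ _)

/-! ## The pair majorant against an abstract census majorant -/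

/-- If `n_r(E') ≤ ofReal (nhi E')` for all levels (`nhi ≥ 0`), then the pair majorant of stub F2 at
`(r, E, Δ)` is at most `ofReal` of the merge and spallation sums of `nhi` (shells bounded by the
census at their lower end). -/
theorem pairMajorant_le_ofReal (Φ : Flow σ N) (r E Δ : ℝ) {nhi : ℝ → ℝ} (h0 : ∀ E', 0 ≤ nhi E')
    (hn : ∀ E', levelCensus σ a₀ θ₀ u₀ N Φ r E' ≤ ENNReal.ofReal (nhi E')) :
    pairMajorant σ a₀ θ₀ u₀ N Φ r E Δ
      ≤ ENNReal.ofReal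
          ((∑ k ∈ Finset.Icc 1 ⌈E / (2 * Δ)⌉₊, nhi (E - ((k : ℝ) + 1) * Δ) * nhi ((k : ℝ) * Δ))
            + ∑ j ∈ Finset.range (⌈E / Δ⌉₊ + 1),
                nhi (((j : ℝ) - 1) * Δ) * nhi (2 * E - ((j : ℝ) + 1) * Δ)) := by
  unfold pairMajorant
  have hterm : ∀ E₁ E₂ E₃ : ℝ, shellCensus σ a₀ θ₀ u₀ N Φ r E₁ E₂ * levelCensus σ a₀ θ₀ u₀ N Φ r E₃
      ≤ ENNReal.ofReal (nhi E₁ * nhi E₃) := by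
    intro E₁ E₂ E₃
    rw [ENNReal.ofReal_mul (h0 _)]
    exact mul_le_mul' ((shellCensus_le_levelCensus Φ r E₁ E₂).trans (hn E₁)) (hn E₃)
  rw [ENNReal.ofReal_add (Finset.sum_nonneg fun k _ => mul_nonneg (h0 _) (h0 _))
      (Finset.sum_nonneg fun j _ => mul_nonneg (h0 _) (h0 _)),
    ENNReal.ofReal_sum_of_nonneg (fun k _ => mul_nonneg (h0 _) (h0 _)),
    ENNReal.ofReal_sum_of_nonneg (fun j _ => mul_nonneg (h0 _) (h0 _))]
  exact add_le_add (Finset.sum_le_sum fun k _ => hterm _ _ _) (Finset.sum_le_sum fun j _ => hterm _ _ _)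

end Summit.AtomisticToContinuum.HydrodynamicLimit.Theorems.EnergyCurrentTailsLevelCensus

end
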